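import Literature.MathematicalPhysics.QuantumLattice.HubbardTTPrimeMeanEnergySupergradient
import HarnessLib

/-!
# Thermodynamic limits of translation-averaged finite MIXTURES of torus vectors
# (density matrices with periodic boundary conditions) and the variational inequality at every coupling

Family `hubbard` (topic `MathematicalPhysics/QuantumLattice`, next to `InfVolFermionState.IsTorusLimitOf`
and `HubbardTTPrimeMeanEnergySupergradient`). Written for the certified fast layer of the Hubbard
re-charter (crew hubbard-fast: planner-p2 TARGET §2.2 (iv) / S4′ "torus-limit thermal convention", ask
L-6b; statements and proofs follow the planner's checked sketch
`HOME/hubbard-fast-p2/lean/TorusLimitMixture.lean`, sha256 2b1bca5b…, re-homed under `Literature/`).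

The tree's predicate `InfVolFermionState.IsTorusLimitOf ω ψ Ls` (Bratteli–Robinson I §4.3.1: averaging a
finite-volume state over the translation group of the torus and passing to a weak-⋆ limit point on the
local algebra) takes ONE torus vector `ψ L` per side. A finite-volume Gibbs state with periodic boundary
conditions — or any density matrix on the `L`-torus Fock space — is a finite MIXTURE
`ρ_L = Σ_i p_{L,i} |ψ_{L,i}⟩⟨ψ_{L,i}|` of unit vectors, and its translation average is the same mixture
of the averaged vector states. This file adds the mixture form of the predicate,

  `IsTorusLimitOfMixture ω m p ψ Ls : ∀ Λ A, Σ_{i < m L} p_{L,i} · torusAvgExpect L Λ A ψ_{L,i} → ω_Λ(A)`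
  along `L = Ls j`,

with real weights `p L : Fin (m L) → ℝ` (nonnegativity and `Σ_i p_{L,i} = 1` are hypotheses of the
theorems that need them, exactly as unit norm is for the pure predicate), and ports the pure API term by
term: the pure predicate is the one-component mixture (`IsTorusLimitOf.isTorusLimitOfMixture`); mixture
torus limits are translation invariant (`IsTorusLimitOfMixture.isTranslationInvariant`) and, for
fixed-particle-number components, even (`IsTorusLimitOfMixture.isEven`); the `t–t'–U` mean energy
`e_Φ(ω)` is the limit of the weighted energies per site at EVERY coupling
(`IsTorusLimitOfMixture.tendsto_meanEnergy_hubbardTTPrime`), the on-site slope is the double-occupancy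
density (`IsTorusLimitOfMixture.meanEnergy_onSite_eq_re_expect_docc`), and — the point of the file —
**the variational inequality at every coupling holds for mixture torus limits**: if the components are
unit `rectN n L`-particle vectors and the weights are a probability vector, then for `U ≥ 0`,
`0 ≤ n < 2` and all `t, t'`,

  `e(t,t',U,n) ≤ e_{Φ(t,t',U)}(ω)`     (`IsTorusLimitOfMixture.energyDensityTT'_le_meanEnergy_hubbardTTPrime`),

because each component is a trial state for `E_{rectN n L}(t,t',U)` (Rayleigh–Ritz,
`LiebThm1.groundEnergy_le_re_expect`) and the weights average the finite-volume inequalities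
(Ruelle 1969 §3.4: the ground-state energy density is the infimum of the mean energy over states;
Bratteli–Kishimoto–Robinson 1978 Thm. 2: translation-invariant ground states minimise the mean energy).
Combined with the affine dependence of `e_Φ(ω)` on the couplings (`meanEnergy_hubbardTTPrime_affine`,
valid for every state) this is the anchor CUT row for torus-limit THERMAL states
(`IsTorusLimitOfMixture.energyDensityTT'_le_meanEnergy_add_slopes`): for every `(t'₀, U₀)`,

  `e(t,t',U,n) ≤ e_{Φ(t,t'₀,U₀)}(ω) + (U − U₀)·Re ω(n_{0↑}n_{0↓}) + (t' − t'₀)·e_{Φ(0,1,0)}(ω)`.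

No ground-state or KMS hypothesis enters: the right-hand side is the (thermal) mean energy of `ω` at the
anchor coupling plus its two slopes, all of which a moment relaxation brackets. One definition
(`IsTorusLimitOfMixture`); everything else is PROVED; no named fact, no numerical input.

## Mathlib / tree search

REUSED: `InfVolFermionState.IsTorusLimitOf` (+ `.isTranslationInvariant`, `.isEven` as templates),
`torusAvgExpect_shift`, `torusAvgExpect_parityAut`, `torusAvgExpect_hubbardTTPrime_meanEnergyObs`,
`torusAvgExpect_docc`, `hubbardTorusTT'_zero_zero_one`, `meanEnergy_hubbardTTPrime_affine`,
`tendsto_energyDensityTT'_torus`, `LiebThm1.groundEnergy_le_re_expect`.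
`lean search 'Mixture|mixture|densityMatrix.*torusAvg'` in `Literature/MathematicalPhysics/QuantumLattice`:
no mixture / density-matrix form of the torus-limit predicate (the thermal files `HubbardTorusThermal*`
work at fixed `L` with Gibbs traces, not with infinite-volume limit states).

## References

* O. Bratteli, D. W. Robinson, *Operator Algebras and Quantum Statistical Mechanics I*, 2nd ed. (1987),
  §4.3.1 (invariant states; averaging over the group; weak-⋆ limit points).
  [cite: BratteliRobinsonI1987, §4.3.1 (PDF pp. 373–375)]
* R. B. Israel, *Convexity in the Theory of Lattice Gases*, Princeton (1979), §I.3, eq. (26) (quantum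
  lattice systems on the torus `T_n = (ℤ/nℤ)^ν`, periodic-boundary-condition Hamiltonian and Gibbs state)
  and §III.1 (limits of periodic-boundary-condition Gibbs states are invariant states). [cite: Israel1979, §I.3 eq. (26)]
* D. Ruelle, *Statistical Mechanics* (1969), §3.4 (the ground-state energy density as an infimum of the
  mean energy over states; trial-state inequality in finite volume). [cite: Ruelle1969, §3.4]
* O. Bratteli, A. Kishimoto, D. W. Robinson, Commun. Math. Phys. 64 (1978) 41, Thm. 2 and §3 (mean energy
  functional, affine in the interaction; ground states minimise it). [cite: BratteliKishimotoRobinson1978, Thm. 2]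
* T. Koma, H. Tasaki, J. Stat. Phys. 76 (1994) 745, §1 (conjugate observable = slope of the energy in a
  coupling). [cite: KomaTasaki1994, §1]
* H. Araki, H. Moriya, Rev. Math. Phys. 15 (2003) 93, §4.1 Def. 4.5 (even states of the fermion
  lattice algebra). [cite: ArakiMoriya2003, §4.1 Def. 4.5]
-/

noncomputable section

namespace Literature.MathematicalPhysics.QuantumLattice

open Matrix Finset HubbardWave0 Literature.Probability.LatticeModels ThermodynamicLimit
open _root_.Filter
open scoped _root_.Topology ComplexOrder BigOperators

namespace InfVolFermionState

variable {d : ℕ}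

/-! ### §1 The predicate and its elementary properties -/

/-- `ω` is a **thermodynamic limit of translation-averaged finite mixtures of torus vectors** along
the sides `Ls j`: at side `L` the mixture has `m L` components `ψ L i` (`i : Fin (m L)`) with real
weights `p L i`, and for every region `Λ` and local observable `A ∈ 𝔄_Λ` the weighted
translation-averaged expectations `Σ_i p_{L,i} · torusAvgExpect L Λ A ψ_{L,i}` converge to `ω_Λ(A)`
along `L = Ls j`, `j → ∞`. For a probability vector `p L` and unit vectors `ψ L i` the `j`-th term is
the expectation of `A` in the translation average of the density matrix `Σ_i p_{L,i}|ψ_{L,i}⟩⟨ψ_{L,i}|`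
on the `Ls j`-torus (e.g. a canonical Gibbs state with periodic boundary conditions, Israel §I.3
eq. (26)); nonnegativity and normalisation of the weights are NOT part of the predicate (the theorems
below that need them take them as hypotheses, as the pure predicate does with `⟨ψ_L, ψ_L⟩ = 1`), nor
is divergence of `Ls`. The pure predicate `IsTorusLimitOf` is the one-component case
(`IsTorusLimitOf.isTorusLimitOfMixture`). Weak-⋆ limit points of group-averaged states:
Bratteli–Robinson I §4.3.1. [cite: BratteliRobinsonI1987, §4.3.1 (PDF pp. 373–375)]
[cite: Israel1979, §I.3 eq. (26)] -/
def IsTorusLimitOfMixture (ω : InfVolFermionState d) (m : ℕ → ℕ) (p : ∀ L, Fin (m L) → ℝ)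
    (ψ : ∀ L, Fin (m L) → Fock (Orb (FermionTorus d L))) (Ls : ℕ → ℕ) : Prop :=
  ∀ (Λ : Finset (Site d)) (A : FermionOp Λ),
    Tendsto (fun j => ∑ i, (p (Ls j) i : ℂ) * torusAvgExpect (Ls j) Λ A (ψ (Ls j) i)) atTop
      (𝓝 (ω.expect Λ A))

/-- Unfolding lemma for `IsTorusLimitOfMixture`. [cite: BratteliRobinsonI1987, §4.3.1 (PDF pp. 373–375)] -/
theorem isTorusLimitOfMixture_iff (ω : InfVolFermionState d) (m : ℕ → ℕ) (p : ∀ L, Fin (m L) → ℝ)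
    (ψ : ∀ L, Fin (m L) → Fock (Orb (FermionTorus d L))) (Ls : ℕ → ℕ) :
    ω.IsTorusLimitOfMixture m p ψ Ls ↔
      ∀ (Λ : Finset (Site d)) (A : FermionOp Λ),
        Tendsto (fun j => ∑ i, (p (Ls j) i : ℂ) * torusAvgExpect (Ls j) Λ A (ψ (Ls j) i)) atTop
          (𝓝 (ω.expect Λ A)) :=
  Iff.rfl

/-- **The pure predicate is the one-component mixture** (`m = 1`, weight `1`).
[cite: BratteliRobinsonI1987, §4.3.1 (PDF pp. 373–375)] -/
theorem IsTorusLimitOf.isTorusLimitOfMixture {ω : InfVolFermionState d}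
    {ψ : ∀ L, Fock (Orb (FermionTorus d L))} {Ls : ℕ → ℕ} (h : ω.IsTorusLimitOf ψ Ls) :
    ω.IsTorusLimitOfMixture (fun _ => 1) (fun _ _ => 1) (fun L _ => ψ L) Ls := by
  intro Λ A
  simpa using h Λ A

/-- Conversely, a one-component mixture with weight `1` is a pure torus limit.
[cite: BratteliRobinsonI1987, §4.3.1 (PDF pp. 373–375)] -/
theorem IsTorusLimitOfMixture.isTorusLimitOf_of_one {ω : InfVolFermionState d}
    {ψ : ∀ L, Fin 1 → Fock (Orb (FermionTorus d L))} {Ls : ℕ → ℕ}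
    (h : ω.IsTorusLimitOfMixture (fun _ => 1) (fun _ _ => 1) ψ Ls) :
    ω.IsTorusLimitOf (fun L => ψ L 0) Ls := by
  intro Λ A
  simpa using h Λ A

/-- Mixture torus limits only depend on the tail of the sequence of sides.
[cite: BratteliRobinsonI1987, §4.3.1 (PDF pp. 373–375)] -/
theorem IsTorusLimitOfMixture.congr {ω : InfVolFermionState d} {m : ℕ → ℕ}
    {p : ∀ L, Fin (m L) → ℝ} {ψ : ∀ L, Fin (m L) → Fock (Orb (FermionTorus d L))} {Ls Ls' : ℕ → ℕ}
    (h : ω.IsTorusLimitOfMixture m p ψ Ls) (hL : ∀ᶠ j in atTop, Ls j = Ls' j) :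
    ω.IsTorusLimitOfMixture m p ψ Ls' := fun Λ A =>
  (h Λ A).congr' (hL.mono fun j hj => by rw [hj])

/-- **Mixture torus limits are translation invariant** (for every `v`, the sequences defining
`(ω ∘ τ_v)_Λ(A)` and `ω_Λ(A)` coincide term by term, `torusAvgExpect_shift`).
Bratteli–Robinson I §4.3.1. [cite: BratteliRobinsonI1987, §4.3.1 (PDF pp. 373–375)] -/
theorem IsTorusLimitOfMixture.isTranslationInvariant {ω : InfVolFermionState d} {m : ℕ → ℕ}
    {p : ∀ L, Fin (m L) → ℝ} {ψ : ∀ L, Fin (m L) → Fock (Orb (FermionTorus d L))} {Ls : ℕ → ℕ}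
    (h : ω.IsTorusLimitOfMixture m p ψ Ls) : ω.IsTranslationInvariant := by
  intro v
  refine InfVolFermionState.ext fun Λ => LinearMap.ext fun A => ?_
  rw [shift_expect]
  refine tendsto_nhds_unique (h (shiftSet v Λ) (fermionEmbed (PolySite.shiftEmb v Λ) A)) ?_
  simp_rw [torusAvgExpect_shift]
  exact h Λ A

/-- **Mixture torus limits of fixed-particle-number families are even states** (each averaged
component is even, `torusAvgExpect_parityAut`). Araki–Moriya (2003) §4.1 Def. 4.5 and Remark 1.
[cite: ArakiMoriya2003, §4.1 Def. 4.5] -/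
theorem IsTorusLimitOfMixture.isEven {ω : InfVolFermionState d} {m : ℕ → ℕ}
    {p : ∀ L, Fin (m L) → ℝ} {ψ : ∀ L, Fin (m L) → Fock (Orb (FermionTorus d L))} {Ls : ℕ → ℕ}
    (h : ω.IsTorusLimitOfMixture m p ψ Ls) {N : ℕ → ℕ} (hψ : ∀ L i, IsNParticle (N L) (ψ L i)) :
    ω.IsEven := by
  intro Λ A
  refine tendsto_nhds_unique (h Λ (parityAut A)) ?_
  have : ∀ j, ∑ i, (p (Ls j) i : ℂ) * torusAvgExpect (Ls j) Λ (parityAut A) (ψ (Ls j) i) =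
      ∑ i, (p (Ls j) i : ℂ) * torusAvgExpect (Ls j) Λ A (ψ (Ls j) i) := fun j =>
    Finset.sum_congr rfl fun i _ => by rw [torusAvgExpect_parityAut _ Λ A (hψ _ i)]
  simp_rw [this]
  exact h Λ A

/-! ### §2 The `t–t'–U` mean energy of a mixture torus limit -/

/-- **The `t–t'` mean energy of a mixture torus limit is the limit of the weighted energies per site
at EVERY coupling**: `Σ_i p_{j,i} · Re⟨ψ_{j,i}, H_{Ls j}(t,t',U) ψ_{j,i}⟩/(Ls j)² → e_{Φ(t,t',U)}(ω)`
(term-by-term `torusAvgExpect_hubbardTTPrime_meanEnergyObs`: the translates of `E_Φ` sum to the torus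
Hamiltonian). [cite: BratteliKishimotoRobinson1978, Thm. 2] -/
theorem IsTorusLimitOfMixture.tendsto_meanEnergy_hubbardTTPrime (t t' U : ℝ)
    {ω : InfVolFermionState 2} {m : ℕ → ℕ} {p : ∀ L, Fin (m L) → ℝ}
    {ψ : ∀ L, Fin (m L) → Fock (Orb (FermionTorus 2 L))} {Ls : ℕ → ℕ}
    (h : ω.IsTorusLimitOfMixture m p ψ Ls) (hLs : Tendsto Ls atTop atTop) :
    Tendsto (fun j => ∑ i, p (Ls j) i *
        ((QuantumLattice.expect (hubbardTorusTT' (Ls j) t t' U) (ψ (Ls j) i)).re / (Ls j : ℝ) ^ 2))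
      atTop (𝓝 (ω.meanEnergy (hubbardTTPrimeFermionInteraction t t' U) 1)) := by
  have hc := (Complex.continuous_re.tendsto _).comp
    (h (thicken ({0} : Finset (Site 2)) 1) ((hubbardTTPrimeFermionInteraction t t' U).meanEnergyObs 1))
  refine hc.congr' ?_
  filter_upwards [hLs.eventually_ge_atTop 3] with j hj
  rw [Function.comp_apply, Complex.re_sum]
  refine Finset.sum_congr rfl fun i _ => ?_
  rw [torusAvgExpect_hubbardTTPrime_meanEnergyObs t t' U hj, ← Complex.ofReal_natCast,
    ← Complex.ofReal_pow, Complex.re_ofReal_mul, Complex.div_ofReal_re]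

/-- **The on-site slope of a mixture torus limit is its double-occupancy density**:
`e_{Φ(0,0,1)}(ω) = Re ω(n_{0↑} n_{0↓})`, provided the sides diverge (term-by-term `torusAvgExpect_docc`
and `H_L(0,0,1) = Σ_x n_{x↑}n_{x↓}`). [cite: KomaTasaki1994, §1] -/
theorem IsTorusLimitOfMixture.meanEnergy_onSite_eq_re_expect_docc
    {ω : InfVolFermionState 2} {m : ℕ → ℕ} {p : ∀ L, Fin (m L) → ℝ}
    {ψ : ∀ L, Fin (m L) → Fock (Orb (FermionTorus 2 L))} {Ls : ℕ → ℕ}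
    (h : ω.IsTorusLimitOfMixture m p ψ Ls) (hLs : Tendsto Ls atTop atTop) :
    ω.meanEnergy (hubbardTTPrimeFermionInteraction 0 0 1) 1 =
      (ω.expect ({0} : Finset (Site 2))
        (nAt 0 (Finset.mem_singleton_self 0) 0 * nAt 0 (Finset.mem_singleton_self 0) 1)).re := by
  have hE := h.tendsto_meanEnergy_hubbardTTPrime 0 0 1 hLs
  have hD := (Complex.continuous_re.tendsto _).comp
    (h ({0} : Finset (Site 2)) (nAt 0 (Finset.mem_singleton_self 0) 0 * nAt 0 (Finset.mem_singleton_self 0) 1))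
  refine tendsto_nhds_unique hE (hD.congr' ?_)
  filter_upwards [hLs.eventually_ge_atTop 1] with j hj
  haveI : NeZero (Ls j) := ⟨by omega⟩
  rw [Function.comp_apply, Complex.re_sum]
  refine Finset.sum_congr rfl fun i _ => ?_
  rw [torusAvgExpect_docc, hubbardTorusTT'_zero_zero_one, ← Complex.ofReal_natCast,
    ← Complex.ofReal_pow, ← Complex.ofReal_inv, ← mul_assoc, ← Complex.ofReal_mul,
    Complex.re_ofReal_mul, mul_assoc, inv_mul_eq_div]

/-! ### §3 The variational inequality at every coupling (the cut row for mixture torus limits) -/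

/-- **The variational inequality at every coupling for mixture torus limits.** If `ω` is the torus
limit along `Ls → ∞` of finite mixtures, with weights `p ≥ 0`, `Σ_i p_{L,i} = 1`, of unit
`rectN n L`-particle vectors, then for `U ≥ 0`, `0 ≤ n < 2` and all `t, t'`:
`e(t,t',U,n) ≤ e_{Φ(t,t',U)}(ω)` — each component is a trial state for `E_{rectN n L}(t,t',U)`
(`LiebThm1.groundEnergy_le_re_expect`), the weights average the inequality, and both sides converge
(`tendsto_energyDensityTT'_torus`, `IsTorusLimitOfMixture.tendsto_meanEnergy_hubbardTTPrime`). Applies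
verbatim to torus limits of canonical Gibbs states (any temperature) in the sectors `rectN n L`.
[cite: Ruelle1969, §3.4] [cite: BratteliKishimotoRobinson1978, Thm. 2] -/
theorem IsTorusLimitOfMixture.energyDensityTT'_le_meanEnergy_hubbardTTPrime (t t' : ℝ) {U : ℝ}
    (hU : 0 ≤ U) {n : ℝ} (hn0 : 0 ≤ n) (hn2 : n < 2)
    {ω : InfVolFermionState 2} {m : ℕ → ℕ} {p : ∀ L, Fin (m L) → ℝ}
    {ψ : ∀ L, Fin (m L) → Fock (Orb (FermionTorus 2 L))} {Ls : ℕ → ℕ}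
    (h : ω.IsTorusLimitOfMixture m p ψ Ls) (hLs : Tendsto Ls atTop atTop)
    (hp0 : ∀ L i, 0 ≤ p L i) (hp1 : ∀ L, ∑ i, p L i = 1)
    (hN : ∀ L i, IsNParticle (rectN n L) (ψ L i))
    (h1 : ∀ L i, star (ψ L i) ⬝ᵥ ψ L i = 1) :
    energyDensityTT' t t' U n ≤ ω.meanEnergy (hubbardTTPrimeFermionInteraction t t' U) 1 := by
  have he := (tendsto_energyDensityTT'_torus t t' hU hn0 hn2).comp hLs
  refine le_of_tendsto_of_tendsto' he (h.tendsto_meanEnergy_hubbardTTPrime t t' U hLs) fun j => ?_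
  simp only [Function.comp_apply]
  calc groundEnergy (hubbardTorusTT' (Ls j) t t' U) (rectN n (Ls j)) / (Ls j : ℝ) ^ 2
      = ∑ i, p (Ls j) i *
          (groundEnergy (hubbardTorusTT' (Ls j) t t' U) (rectN n (Ls j)) / (Ls j : ℝ) ^ 2) := by
        rw [← Finset.sum_mul, hp1, one_mul]
    _ ≤ ∑ i, p (Ls j) i *
          ((QuantumLattice.expect (hubbardTorusTT' (Ls j) t t' U) (ψ (Ls j) i)).re /
            (Ls j : ℝ) ^ 2) :=
        Finset.sum_le_sum fun i _ => mul_le_mul_of_nonneg_left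
          (div_le_div_of_nonneg_right
            (LiebThm1.groundEnergy_le_re_expect _ (hN _ i) (h1 _ i)) (sq_nonneg _)) (hp0 _ i)

/-- **The anchor cut row for mixture (e.g. thermal) torus limits.** Under the hypotheses of
`energyDensityTT'_le_meanEnergy_hubbardTTPrime`, for every anchor coupling `(t'₀, U₀)` (no sign
condition) and every `t'`, `U ≥ 0`:
`e(t,t',U,n) ≤ e_{Φ(t,t'₀,U₀)}(ω) + (U − U₀)·Re ω(n_{0↑}n_{0↓}) + (t' − t'₀)·e_{Φ(0,1,0)}(ω)` —
the variational inequality at `(t', U)` rewritten with the affine dependence of the mean energy on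
the couplings (`meanEnergy_hubbardTTPrime_affine`, valid for every state) and the on-site slope
identified with the double-occupancy density. No ground-state hypothesis on `ω`.
[cite: Ruelle1969, §3.4] [cite: KomaTasaki1994, §1] -/
theorem IsTorusLimitOfMixture.energyDensityTT'_le_meanEnergy_add_slopes (t t'₀ U₀ : ℝ) {n : ℝ}
    (hn0 : 0 ≤ n) (hn2 : n < 2)
    {ω : InfVolFermionState 2} {m : ℕ → ℕ} {p : ∀ L, Fin (m L) → ℝ}
    {ψ : ∀ L, Fin (m L) → Fock (Orb (FermionTorus 2 L))} {Ls : ℕ → ℕ}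
    (h : ω.IsTorusLimitOfMixture m p ψ Ls) (hLs : Tendsto Ls atTop atTop)
    (hp0 : ∀ L i, 0 ≤ p L i) (hp1 : ∀ L, ∑ i, p L i = 1)
    (hN : ∀ L i, IsNParticle (rectN n L) (ψ L i))
    (h1 : ∀ L i, star (ψ L i) ⬝ᵥ ψ L i = 1) (t' : ℝ) {U : ℝ} (hU : 0 ≤ U) :
    energyDensityTT' t t' U n ≤
      ω.meanEnergy (hubbardTTPrimeFermionInteraction t t'₀ U₀) 1 +
        (U - U₀) * (ω.expect ({0} : Finset (Site 2))
          (nAt 0 (Finset.mem_singleton_self 0) 0 * nAt 0 (Finset.mem_singleton_self 0) 1)).re +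
          (t' - t'₀) * ω.meanEnergy (hubbardTTPrimeFermionInteraction 0 1 0) 1 := by
  have hvar := h.energyDensityTT'_le_meanEnergy_hubbardTTPrime t t' hU hn0 hn2 hLs hp0 hp1 hN h1
  rw [ω.meanEnergy_hubbardTTPrime_affine t t'₀ U₀ t' U, h.meanEnergy_onSite_eq_re_expect_docc hLs]
    at hvar
  exact hvar

end InfVolFermionState

end Literature.MathematicalPhysics.QuantumLattice
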